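/-
Copyright (c) 2026. All rights reserved.
Released under Apache 2.0 license as described in the file LICENSE.
Authors: abc-iut cell, prover seat abc-iut-L4-t6 (gen 14; cell row S3 «ARC-LTIMES-CARRIER», L4-lead m169/m170), over this
seat's `⋉`-carrier `archGenuinePlus` (file 1), abc-iut-w5-d038's archimedean `η⊢` (`ArchimedeanHolGroupPairsEta*.lean`) and
abc-iut-L4-t3's add-ons re-elaborated over the `⋉`-successor (`Ltimes/LogFrobeniusMonoAnalyticization.lean`,
`Ltimes/LogFrobeniusMonoTelecoreCoherence.lean`).
-/
import Literature.AnabelianGeometry.AbsoluteAnabelian.Ltimes.LogFrobeniusArchGenuinePlus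
import Literature.AnabelianGeometry.AbsoluteAnabelian.Ltimes.LogFrobeniusMonoTelecoreCoherence
import HarnessLib

/-!
# [AbsTopIII] Cor 5.10 (iv)(c): the natural isomorphisms `η⊢_{v,ν}` AT THE `⋉`-CARRIER WITH GENUINE ARCHIMEDEAN `⊞`-SIDE —
# abc-iut-L4-t3's add-on `MonoTelecoreCoherence` INHABITED at a genuine archimedean `TH⊞`-carrier

S. Mochizuki, *Topics in absolute anabelian geometry III: global reconstruction algorithms*, J. Math. Sci. Univ.
Tokyo 22 (2015) 939–1156 [MochizukiAbsTopIII2015]; locators `p.N` = pages of the author's manuscript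
(`paper:url-5493eb38cbb7`): Cor 5.10 (iv)(c) p. 148 ("there is a natural isomorphism `η⊢_{v,ν}` from the composite functor
determined by the path `γ¹_{v,ν}` [`𝒳 → 𝒩⊞_v → 𝒩_v → ℰ• → ℰ⊢ → An⊢[𝒩⊢⊞] → 𝒩⊢⊞_v`] … to the composite functor determined by the
path `γ⁰_{v,ν}` [`𝒳 → 𝒩⊞_v → 𝒩⊢⊞_v`] … the resulting homotopies `η⊢_{v,ν}`, `(η⊢_{v,ν})⁻¹`, together with the
mono-analyticization homotopies … generate a contact structure `ℋ_{An⊢}` on `𝔗_{An⊢}`"), Cor 5.10 preamble p. 146 (the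
mono-analyticization homotopies), Prop 5.8 (iv)/(v)/(vii) pp. 140–142 (`k∼(G)`, `k×(G)`, `ψ^{An⊢⊞}_{w,ν}` over `Th⊢[Z]`), Def 5.6
(iv) p. 136 (`𝒞^hol_{TH⊞} → 𝒞^{hol⊢}_{TB⊞}`), Rmk 5.8.1 (i) p. 142 (mono-analyticization forgets the holomorphic
rigidification — the source of the orientation signs).

## What this file builds (cell row S3, file 2; L4-lead m170 (M1): "the `⋉`-typed arc (b)(c) closer at a genuine arc `TH⊞` carrier")

Over the FROZEN interface the `η⊢`-datum is EMPTY at every carrier with print's archimedean shapes (abc-iut-L4-t3's N1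
`LogFrobeniusArchPlusNoGo.lean`).  At this seat's `⋉`-carrier `archGenuinePlus 𝔄` (file 1: `𝒩⊞_v := 𝒞^hol_{TH⊞}`, `ι⊞` on
`Γ⃗^⋉_arc` only, `𝒩⊞_v → 𝒩⊢⊞_v` genuine in both components, `ψ := ψArc`) it EXISTS:

* `archEtaSnd 𝔄 c hc hcob b ν` — its `TB⊞`-component, per kind of place and vertex: abc-iut-w5-d038's `etaTimes⁻¹`
  (`k×(G_𝕏) ⥲ (k^×)^{TB⊞}`) at the archimedean `k^×`, `etaTilde⁻¹` (`k∼(G_𝕏) ⥲ (k∼)^{TB⊞}`) at every vertex reading `k∼`;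
* ★★ `archEtaPlus 𝔄 c hc hcob b ν` — **`η⊢_{v,ν} : γ¹_{v,ν} ⥲ γ⁰_{v,ν}` AT THE CARRIER, for EVERY place and vertex**: the identity
  of `G_𝕏` on the `TM⊢`-component, `archEtaSnd` on the `TB⊞`-component; NATURAL in `(𝕏 ↶ k)` under abc-iut-w5-d038's
  orientation cochain `(c, hc, hcob)` for the transition signs `ε_f = c_𝕏 c_𝕐` (NECESSARY: `ArchimedeanHolGroupPairsEtaNoGo.lean`;
  AVAILABLE with `c ≡ 1` at the geometric Aut-holomorphic field functor of any class of hyperbolic Riemann surfaces,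
  `HolRS.exists_orientationCochain_geometric`); `archGenuinePlus_eta` — the same in the binder shape of the add-on's field
  `eta`; `archEtaPlus_hom_app_fst` / `archGenuinePlus_toEmono_map_eta` — `η⊢` lies over `ℰ⊢` ON THE NOSE;
* ★★ `archGenuinePlus_eta_over` — the coherence "`η⊢_{v,ν}` lies over `ℰ⊢`" (abc-iut-f-101's `hcoh`) HOLDS: all five legs over
  the base are identities of `G_𝕐` (file 1 §0/§5);
* ★ `archGenuinePlus_monoAnalyticizationHomotopies` — the add-on (a)+(b) over the successor (relay slice T4a) INHABITED at the
  carrier (rows 4 → 5 the identity, rows 6 → 7 the unit of `Th⊢ ⥲ An⊢`); `archGenuinePlus_cor510MonoCores` — Cor 5.10 (iv)(a)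
  for `V(F_mod) ≠ ∅` (abc-iut-L4-t3's `cor510MonoCores_holds` over the successor);
* ★★★ `archGenuinePlus_monoTelecoreCoherence 𝔄 Vmod isArc c hc hcob` — **the add-on (c)+(d)+coherence `MonoTelecoreCoherence`
  (relay slice T7a) INHABITED AT A GENUINE ARCHIMEDEAN `TH⊞`-CARRIER**, under the orientation cochain;
  `nonempty_monoTelecoreCoherence_archGenuinePlus_of_cochain`; ★★★ `HolRS.nonempty_monoTelecoreCoherence_archGenuinePlus_geometric`
  — ZERO HYPOTHESES at `geometricAutHolFieldFunctor Q`, over every index set;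
* `archGenuinePlus_monoTelecore` — Cor 5.10 (iv)(b) over the add-on: abc-iut-f-101's mono-analytic telecore `𝔗_{An⊢}` at the
  carrier, by name (`MonoTelecoreCoherence.monoTelecore`);
* ★★ `frozen_isEmpty_successor_nonempty` — CONTRAST IN ONE LINE: with the SAME holomorphic rows, the SAME `ψ`-side `ψArc`
  (print's shapes `k∼(G) ≅ ℝ²`, `k×(G) ⊃ S¹`) and the same Aut-holomorphic field functor, abc-iut-L4-t3's add-on is EMPTY over
  the frozen interface at abc-iut-w6-d025's arc chart for EVERY `M` (N1) and INHABITED over the `⋉`-successor at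
  `archGenuinePlus` — the typing finding T3g9-F1 on OUR interface, settled in the kernel on both sides.

What remains for the node's M1 (L4-lead m170): the PINNED Cor 5.10 (iv)(b)(c) closer `MonoTelecoreCoherence.cor510MonoTelecorePinned`
(abc-iut-f-101's sufficiency theorem, relay slice T7b of abc-iut-L4-t8) applied to this `(M, K)` — one line once
`Ltimes/LogFrobeniusMonoTelecoreContact.lean` is in the tree.

HONEST LIMITS (named): those of file 1 ((L2) nonarchimedean places of this setting are stand-ins — over an all-archimedean
index nothing on the holomorphic or `ψ`-side is; (L-N⊢) `𝒩⊢_w` read through `ℰ⊢`; (L3) `Orb(−)` read as the identity, whence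
the cochain; (L4) one CAF chart per `𝕏`); the cochain hypothesis is GENUINE CONTENT (Rmk 5.8.1 (i): anti-holomorphic
morphisms of `EA` flip the orientation; at abc-iut-L4-t2's `RC`-model with `conj` there is NO `η⊢` without `Orb`-coarsening,
abc-iut-w5-d038's `HolRS.RC.isEmpty_eta_natTrans`).  MODEL-LEVEL; a carrier of OUR successor typing, print unchanged; refereed
pre-IUT material; nothing here bears on [IUTchIII] Cor. 3.12; no side taken; instantiated ≠ endorsed; typed ≠ proved.
-/

set_option autoImplicit false

noncomputable section

universe u

open CategoryTheory

namespace Literature.AnabelianGeometry.AbsoluteAnabelian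

namespace LogFrobeniusSettingLtimes

variable (𝔄 : AutHolFieldFunctor.{u})

/-! ## §1. The natural isomorphisms `η⊢_{v,ν}` of Cor 5.10 (iv)(c) at the carrier -/

/-- The `TB⊞`-component of `η⊢_{v,ν}`, per kind of place and vertex, as an isomorphism of functors `𝒞^hol_TF ⥤ TB⊞`:
`k×(G_𝕏) ⥲ (k^×)^{TB⊞}` (abc-iut-w5-d038's `etaTimes⁻¹`) at the archimedean vertex `k^×`, `k∼(G_𝕏) ⥲ (k∼)^{TB⊞}`
(`etaTilde⁻¹`) at every vertex reading `k∼` — NATURAL in `(𝕏 ↶ k)` under the orientation cochain `(c, hc, hcob)`.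
[cite: MochizukiAbsTopIII2015, Cor 5.10 (iv)(c) p. 148] -/
def archEtaSnd (c : 𝔄.EA → ℝ) (hc : ∀ X : 𝔄.EA, c X = 1 ∨ c X = -1)
    (hcob : ∀ {X Y : 𝔄.EA} (f : X ⟶ Y), AutHolFieldFunctor.transitionSign f = c X * c Y)
    : (b : Bool) → (ν : LogVertex b) →
    ((archLamPlusBase 𝔄 b ν ⋙ HolTHPlusPair.toEA 𝔄) ⋙ 𝔄.toTMMono ⋙ TMMono.arcContainer b ν ≅
      archLamPlusBase 𝔄 b ν ⋙ HolTHPlusPair.toTBPlus 𝔄 ⋙ TBPlus.uliftFunctor.{u + 1})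
  | true, ArchVertex.mult => (HolTFPair.etaTimes 𝔄 c hc hcob).symm
  | true, ArchVertex.postLog => (HolTFPair.etaTilde 𝔄 c hc hcob).symm
  | true, ArchVertex.pre => (HolTFPair.etaTilde 𝔄 c hc hcob).symm
  | true, ArchVertex.spaceLink => (HolTFPair.etaTilde 𝔄 c hc hcob).symm
  | false, _ => (HolTFPair.etaTilde 𝔄 c hc hcob).symm

/-- ★★ **The natural isomorphism `η⊢_{v,ν}` of Cor 5.10 (iv)(c) AT THE CARRIER**, for every kind of place `b` and EVERY
vertex `ν`: between the functor of `γ¹_{v,ν} = 𝒳 →(λ⊞_{v,ν}) 𝒩⊞_v → 𝒩_v → ℰ• → ℰ⊢ ⥲ An⊢[𝒩⊢⊞] →(ψ^{An⊢⊞}_{v,ν}) 𝒩⊢⊞_v` and the functor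
of `γ⁰_{v,ν} = 𝒳 →(λ⊞_{v,ν}) 𝒩⊞_v → 𝒩⊢⊞_v` — the identity of `G_𝕏` on the `TM⊢`-component, `archEtaSnd` on the
`TB⊞`-component; naturality in `(𝕏 ↶ k)` is abc-iut-w5-d038's (`σ(G_f) = ε_f σ_𝕏 σ_𝕐` against the cochain).
[cite: MochizukiAbsTopIII2015, Cor 5.10 (iv)(c) p. 148] -/
def archEtaPlus (c : 𝔄.EA → ℝ) (hc : ∀ X : 𝔄.EA, c X = 1 ∨ c X = -1)
    (hcob : ∀ {X Y : 𝔄.EA} (f : X ⟶ Y), AutHolFieldFunctor.transitionSign f = c X * c Y)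
    (b : Bool) (ν : LogVertex b) :
    archLamPlus 𝔄 b ν ⋙ Up.liftF (HolTHPlusPair.forgetTH 𝔄) ⋙ Up.liftF (HolTHPair.toEA 𝔄) ⋙
        (inducedFunctor _ ⋙ 𝔄.toTMMono) ⋙ TMMono.anArcEquiv.{u + 1}.functor ⋙ TMMono.ψArc b ν ≅
      archLamPlus 𝔄 b ν ⋙ archMonoNplus 𝔄 :=
  NatIso.ofComponents
    (fun x => Iso.prod (Iso.refl _) ((archEtaSnd 𝔄 c hc hcob b ν).app x.down))
    (fun f => Prod.ext ((Category.comp_id _).trans (Category.id_comp _).symm)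
      ((archEtaSnd 𝔄 c hc hcob b ν).hom.naturality f.hom))

/-- `η⊢_{v,ν}` lies over `ℰ⊢` ON THE NOSE: its `TM⊢`-component is the identity of `G_𝕏`.
[cite: MochizukiAbsTopIII2015, Cor 5.10 (iv)(c) p. 148] -/
theorem archEtaPlus_hom_app_fst (c : 𝔄.EA → ℝ) (hc : ∀ X : 𝔄.EA, c X = 1 ∨ c X = -1)
    (hcob : ∀ {X Y : 𝔄.EA} (f : X ⟶ Y), AutHolFieldFunctor.transitionSign f = c X * c Y)
    (b : Bool) (ν : LogVertex b) (x : Up (HolTFPair 𝔄)) :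
    ((archEtaPlus 𝔄 c hc hcob b ν).hom.app x).1 = 𝟙 _ := rfl

variable (Vmod : Type (u + 1)) (isArc : Vmod → Bool)

/-- ★★ **`η⊢_{v,ν}` in the binder shape of abc-iut-L4-t3's add-on `MonoTelecoreCoherence`** (field `eta`), at the carrier
`archGenuinePlus`: for every place `v` and every cross vertex `ν ∈ Γ⃗^×_v`.
[cite: MochizukiAbsTopIII2015, Cor 5.10 (iv)(c) p. 148] -/
def archGenuinePlus_eta (c : 𝔄.EA → ℝ) (hc : ∀ X : 𝔄.EA, c X = 1 ∨ c X = -1)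
    (hcob : ∀ {X Y : 𝔄.EA} (f : X ⟶ Y), AutHolFieldFunctor.transitionSign f = c X * c Y)
    (v : Vmod) (ν : LogVertex (isArc v)) (hν : ν.IsCross) :
    (archGenuinePlus 𝔄 Vmod isArc).lam v ν ⋙ (archGenuinePlus 𝔄 Vmod isArc).forget v ⋙
        (archGenuinePlus 𝔄 Vmod isArc).toE v ⋙ (archGenuinePlus 𝔄 Vmod isArc).monoAn ⋙
          (archGenuinePlus 𝔄 Vmod isArc).κAnMono.functor ⋙ (archGenuinePlus 𝔄 Vmod isArc).ψAnMono v ⟨ν, hν⟩ ≅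
      (archGenuinePlus 𝔄 Vmod isArc).lam v ν ⋙ (archGenuinePlus 𝔄 Vmod isArc).monoNplus v :=
  archEtaPlus 𝔄 c hc hcob (isArc v) ν

/-- The image of `η⊢_{v,ν,y}` under `𝒩⊢⊞_v → 𝒩⊢_v → ℰ⊢` is the identity of `G_𝕐` (first ingredient of the coherence
"`η⊢_{v,ν}` lies over `ℰ⊢`", field `eta_over` of abc-iut-L4-t3's add-on). [cite: MochizukiAbsTopIII2015, Cor 5.10 (iv)(c) p. 148] -/
theorem archGenuinePlus_toEmono_map_eta (c : 𝔄.EA → ℝ) (hc : ∀ X : 𝔄.EA, c X = 1 ∨ c X = -1)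
    (hcob : ∀ {X Y : 𝔄.EA} (f : X ⟶ Y), AutHolFieldFunctor.transitionSign f = c X * c Y)
    (v : Vmod) (ν : LogVertex (isArc v)) (hν : ν.IsCross)
    (y : (archGenuinePlus 𝔄 Vmod isArc).X) :
    ((archGenuinePlus 𝔄 Vmod isArc).toEmono v).map (((archGenuinePlus 𝔄 Vmod isArc).forgetMono v).map
      ((archGenuinePlus_eta 𝔄 Vmod isArc c hc hcob v ν hν).hom.app y)) = 𝟙 _ := rfl


/-! ## §2. The coherence "`η⊢_{v,ν}` lies over `ℰ⊢`" -/

/-- ★★ **The coherence "`η⊢_{v,ν}` lies over `ℰ⊢`"** (field `eta_over` of `MonoTelecoreCoherence`, abc-iut-f-101's `hcoh`) HOLDS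
at the carrier: every leg over the base is an identity of `G_𝕐 ∈ TM⊢` — the `η`-image (`archGenuinePlus_toEmono_map_eta`), the
rows-3→4 homotopy (`Iso.refl`), the rows-4→5 homotopy (`archGenuinePlus_toEIso`), "`ψ` over `ℰ⊢`" (`archGenuinePlus_ψOverIso`),
and the unit of `Th⊢ ⥲ An⊢` (`TMMono.anArcEquiv_unitIso_inv_app`). [cite: MochizukiAbsTopIII2015, Cor 5.10 (iv)(c) p. 148] -/
theorem archGenuinePlus_eta_over (c : 𝔄.EA → ℝ) (hc : ∀ X : 𝔄.EA, c X = 1 ∨ c X = -1)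
    (hcob : ∀ {X Y : 𝔄.EA} (f : X ⟶ Y), AutHolFieldFunctor.transitionSign f = c X * c Y)
    (v : Vmod) (ν : LogVertex (isArc v)) (hν : ν.IsCross) (y : (archGenuinePlus 𝔄 Vmod isArc).X) :
    ((archGenuinePlus 𝔄 Vmod isArc).toEmono v).map (((archGenuinePlus 𝔄 Vmod isArc).forgetMono v).map
        ((archGenuinePlus_eta 𝔄 Vmod isArc c hc hcob v ν hν).hom.app y)) ≫
        ((archGenuinePlus 𝔄 Vmod isArc).toEmono v).map (((archGenuinePlus 𝔄 Vmod isArc).monoHomotopy v).hom.app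
          (((archGenuinePlus 𝔄 Vmod isArc).lam v ν).obj y)) ≫
          (archGenuinePlus_toEIso 𝔄 Vmod isArc v).hom.app
            (((archGenuinePlus 𝔄 Vmod isArc).forget v).obj (((archGenuinePlus 𝔄 Vmod isArc).lam v ν).obj y)) =
      (archGenuinePlus_ψOverIso 𝔄 Vmod isArc v ⟨ν, hν⟩).hom.app
          (((archGenuinePlus 𝔄 Vmod isArc).lam v ν ⋙ (archGenuinePlus 𝔄 Vmod isArc).forget v ⋙
            (archGenuinePlus 𝔄 Vmod isArc).toE v ⋙ (archGenuinePlus 𝔄 Vmod isArc).monoAn ⋙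
              (archGenuinePlus 𝔄 Vmod isArc).κAnMono.functor).obj y) ≫
        (archGenuinePlus 𝔄 Vmod isArc).κAnMono.unitIso.inv.app
          (((archGenuinePlus 𝔄 Vmod isArc).lam v ν ⋙ (archGenuinePlus 𝔄 Vmod isArc).forget v ⋙
            (archGenuinePlus 𝔄 Vmod isArc).toE v ⋙ (archGenuinePlus 𝔄 Vmod isArc).monoAn).obj y) := by
  rw [archGenuinePlus_toEmono_map_eta]
  change 𝟙 _ ≫ 𝟙 _ ≫ 𝟙 _ = 𝟙 _ ≫ TMMono.anArcEquiv.unitIso.inv.app _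
  rw [TMMono.anArcEquiv_unitIso_inv_app]
  simp only [Category.comp_id]
  rfl


/-! ## §3. abc-iut-L4-t3's add-ons INHABITED at the carrier -/

/-- ★ (a)+(b): the mono-analyticization homotopies over the successor (relay slice T4a) at the carrier — rows 4 → 5 the
identity, rows 6 → 7 the unit of the Prop 5.8 (vii) equivalence `Th⊢ ⥲ An⊢` (file 1 §5).
[cite: MochizukiAbsTopIII2015, Cor 5.10 p. 146] -/
def archGenuinePlus_monoAnalyticizationHomotopies :
    (archGenuinePlus 𝔄 Vmod isArc).MonoAnalyticizationHomotopies where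
  toE := archGenuinePlus_toEIso 𝔄 Vmod isArc
  anToE := archGenuinePlus_anToEIso 𝔄 Vmod isArc

/-- **[AbsTopIII] Cor 5.10 (iv)(a) HOLDS at the carrier** for `V(F_mod) ≠ ∅` (abc-iut-L4-t3's `cor510MonoCores_holds` over the
successor, fed with the inhabited add-on). [cite: MochizukiAbsTopIII2015, Cor 5.10 (iv)(a) p. 147] -/
theorem archGenuinePlus_cor510MonoCores [Nonempty Vmod] : (archGenuinePlus 𝔄 Vmod isArc).Cor510MonoCores :=
  cor510MonoCores_holds (archGenuinePlus_monoAnalyticizationHomotopies 𝔄 Vmod isArc)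

/-- ★★★ (c)+(d)+coherence: **abc-iut-L4-t3's add-on `MonoTelecoreCoherence` INHABITED AT A GENUINE ARCHIMEDEAN `TH⊞`-CARRIER**
— `psiOver` the identity ("`ψ` over `ℰ⊢`" on the nose), `eta := archGenuinePlus_eta` (abc-iut-w5-d038's `η⊢` on the
`TB⊞`-components, the identity of `G_𝕏` on the base), `eta_over := archGenuinePlus_eta_over`; under the orientation cochain
`(c, hc, hcob)`. [cite: MochizukiAbsTopIII2015, Cor 5.10 (iv)(c) p. 148] -/
def archGenuinePlus_monoTelecoreCoherence (c : 𝔄.EA → ℝ) (hc : ∀ X : 𝔄.EA, c X = 1 ∨ c X = -1)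
    (hcob : ∀ {X Y : 𝔄.EA} (f : X ⟶ Y), AutHolFieldFunctor.transitionSign f = c X * c Y) :
    (archGenuinePlus 𝔄 Vmod isArc).MonoTelecoreCoherence
      (archGenuinePlus_monoAnalyticizationHomotopies 𝔄 Vmod isArc) where
  psiOver w j := archGenuinePlus_ψOverIso 𝔄 Vmod isArc w j
  eta v ν hν := archGenuinePlus_eta 𝔄 Vmod isArc c hc hcob v ν hν
  eta_over v ν hν y := archGenuinePlus_eta_over 𝔄 Vmod isArc c hc hcob v ν hν y

/-- **Cor 5.10 (iv)(b) over the add-on at the carrier**: abc-iut-f-101's mono-analytic telecore `𝔗_{An⊢}` (telecore edges the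
genuine `ψArc`), by name, for `V(F_mod) ≠ ∅`. [cite: MochizukiAbsTopIII2015, Cor 5.10 (iv)(b) p. 147] -/
def archGenuinePlus_monoTelecore [Nonempty Vmod] (c : 𝔄.EA → ℝ) (hc : ∀ X : 𝔄.EA, c X = 1 ∨ c X = -1)
    (hcob : ∀ {X Y : 𝔄.EA} (f : X ⟶ Y), AutHolFieldFunctor.transitionSign f = c X * c Y) :
    ((archGenuinePlus 𝔄 Vmod isArc).subdiagram (monoBase 6)).Telecore
      ((archGenuinePlus 𝔄 Vmod isArc).monoCoreObs (archGenuinePlus_monoAnalyticizationHomotopies 𝔄 Vmod isArc).toE)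
      ((archGenuinePlus 𝔄 Vmod isArc).monoCoreObs_isCore (archGenuinePlus_monoAnalyticizationHomotopies 𝔄 Vmod isArc).toE) :=
  (archGenuinePlus_monoTelecoreCoherence 𝔄 Vmod isArc c hc hcob).monoTelecore

/-- **Existence form**: an orientation cochain for the transition signs of `𝔄` yields the add-on at the carrier.
[cite: MochizukiAbsTopIII2015, Cor 5.10 (iv)(c) p. 148] -/
theorem nonempty_monoTelecoreCoherence_archGenuinePlus_of_cochain
    (h : ∃ c : 𝔄.EA → ℝ, (∀ X, c X = 1 ∨ c X = -1) ∧
      ∀ {X Y : 𝔄.EA} (f : X ⟶ Y), AutHolFieldFunctor.transitionSign f = c X * c Y) :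
    Nonempty ((archGenuinePlus 𝔄 Vmod isArc).MonoTelecoreCoherence
      (archGenuinePlus_monoAnalyticizationHomotopies 𝔄 Vmod isArc)) := by
  obtain ⟨c, hc, hcob⟩ := h
  exact ⟨archGenuinePlus_monoTelecoreCoherence 𝔄 Vmod isArc c hc hcob⟩

/-! ## §4. Contrast with the frozen interface, in one line -/

/-- ★★ **Typing finding T3g9-F1, settled in the kernel on both sides.**  With the SAME Aut-holomorphic field functor `𝔄`, the
SAME holomorphic rows and the SAME `ψ`-side `ψArc` (print's shapes: `k∼(G) ≅ ℝ²` plane-type at `pre`, `k×(G) ⊃ S¹` circle-type at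
`mult`), over a nonempty all-archimedean index and as soon as `𝒞^hol_TF` has an object: abc-iut-L4-t3's add-on
`MonoTelecoreCoherence` is EMPTY over the FROZEN interface at abc-iut-w6-d025's arc chart for EVERY choice of the
mono-analyticization homotopies (N1, `isEmpty_monoTelecoreCoherence_archGenuineMonoAnChart`: the frozen `ι⊞` along `k^× ↪ k`),
and INHABITED over the `⋉`-SUCCESSOR at `archGenuinePlus` (this file), given an orientation cochain.
[cite: MochizukiAbsTopIII2015, Cor 5.10 (iv)(c) p. 148] -/
theorem frozen_isEmpty_successor_nonempty (Vmod : Type (u + 1)) [Nonempty Vmod] [Nonempty (HolTFPair 𝔄)]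
    (h : ∃ c : 𝔄.EA → ℝ, (∀ X, c X = 1 ∨ c X = -1) ∧
      ∀ {X Y : 𝔄.EA} (f : X ⟶ Y), AutHolFieldFunctor.transitionSign f = c X * c Y) :
    (∀ M : (LogFrobeniusSetting.archGenuineMonoAnChart 𝔄 Vmod (fun _ => true)).MonoAnalyticizationHomotopies,
        IsEmpty ((LogFrobeniusSetting.archGenuineMonoAnChart 𝔄 Vmod (fun _ => true)).MonoTelecoreCoherence M)) ∧
      Nonempty ((archGenuinePlus 𝔄 Vmod (fun _ => true)).MonoTelecoreCoherence
        (archGenuinePlus_monoAnalyticizationHomotopies 𝔄 Vmod (fun _ => true))) :=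
  ⟨LogFrobeniusSetting.isEmpty_monoTelecoreCoherence_archGenuineMonoAnChart 𝔄 Vmod,
    nonempty_monoTelecoreCoherence_archGenuinePlus_of_cochain 𝔄 Vmod (fun _ => true) h⟩

end LogFrobeniusSettingLtimes

/-! ## §5. The geometric case: zero hypotheses -/

namespace HolRS

/-- ★★★ **At the geometric Aut-holomorphic field functor of any class `Q` of hyperbolic Riemann surfaces, abc-iut-L4-t3's add-on
`MonoTelecoreCoherence` is INHABITED at the `⋉`-carrier with genuine archimedean `⊞`-side, with ZERO hypotheses**, over every
index set (there every transition sign is `+1`, `HolRS.exists_orientationCochain_geometric`).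
[cite: MochizukiAbsTopIII2015, Cor 5.10 (iv)(c) p. 148] -/
theorem nonempty_monoTelecoreCoherence_archGenuinePlus_geometric (Q : ObjectProperty HolRS) (Vmod : Type 1)
    (isArc : Vmod → Bool) :
    Nonempty ((LogFrobeniusSettingLtimes.archGenuinePlus (geometricAutHolFieldFunctor Q) Vmod isArc).MonoTelecoreCoherence
      (LogFrobeniusSettingLtimes.archGenuinePlus_monoAnalyticizationHomotopies (geometricAutHolFieldFunctor Q) Vmod isArc)) :=
  LogFrobeniusSettingLtimes.nonempty_monoTelecoreCoherence_archGenuinePlus_of_cochain _ Vmod isArc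
    (exists_orientationCochain_geometric Q)

/-- Hence, at the geometric functor over a nonempty all-archimedean index with `𝒞^hol_TF` nonempty: the frozen-interface add-on
is EMPTY at the arc chart for every `M`, the successor add-on is INHABITED at `archGenuinePlus` — no hypothesis at all.
[cite: MochizukiAbsTopIII2015, Cor 5.10 (iv)(c) p. 148] -/
theorem frozen_isEmpty_successor_nonempty_geometric (Q : ObjectProperty HolRS) (Vmod : Type 1) [Nonempty Vmod]
    [Nonempty (HolTFPair (geometricAutHolFieldFunctor Q))] :
    (∀ M : (LogFrobeniusSetting.archGenuineMonoAnChart (geometricAutHolFieldFunctor Q) Vmod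
        (fun _ => true)).MonoAnalyticizationHomotopies,
        IsEmpty ((LogFrobeniusSetting.archGenuineMonoAnChart (geometricAutHolFieldFunctor Q) Vmod
          (fun _ => true)).MonoTelecoreCoherence M)) ∧
      Nonempty ((LogFrobeniusSettingLtimes.archGenuinePlus (geometricAutHolFieldFunctor Q) Vmod
          (fun _ => true)).MonoTelecoreCoherence
        (LogFrobeniusSettingLtimes.archGenuinePlus_monoAnalyticizationHomotopies (geometricAutHolFieldFunctor Q) Vmod
          (fun _ => true))) :=
  LogFrobeniusSettingLtimes.frozen_isEmpty_successor_nonempty _ Vmod (exists_orientationCochain_geometric Q)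

end HolRS

end Literature.AnabelianGeometry.AbsoluteAnabelian

end
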